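import Summits.ABC.IUTFork.Cor312ProvenanceDH
import Summits.ABC.IUTFork.Thm311RealM
import Summits.ABC.IUTFork.Thm311Real
import Literature.IUT.HodgeTheaters.InitialThetaDataPlaces
import HarnessLib

/-!
# [IUTchI] Def. 3.1 (b)/(e) index bookkeeping for Dupuy–Hilado-indexed settings: the NATURAL PROJECTION
# `𝕍(F) ↠ V̲` — it exists, is unique, surjective, carries `𝕍(F)^bad = S` onto (and back from) `V̲^bad`, and is a
# bijection on the bad part iff no place of `𝕍^bad_mod` has two places of `F` above it

S. Mochizuki, *Inter-universal Teichmüller theory I*, §3, Def. 3.1 (b) "`V(F)^bad := V^bad_mod ×_{V_mod} V(F)`", (e) "`V̲ ⊆ V(K)`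
… induces a natural bijection `V̲ ⥲ V_mod`, i.e., a section of the natural surjection `V(K) ↠ V_mod`" (kurims final manuscript
pp. 61–62); [IUTchIV] Thm. 1.10 p. 23 ("`𝕍(F□)^bad`"); T. Dupuy, A. Hilado, *The statement of Mochizuki's Corollary 3.12*, §3.3
(`S` = the places of `F` of bad multiplicative reduction), §3.6 (index spaces `V(F)_p`).

PROOF-ONLY record file (D-0012; no `def`, no `Prop` fact, no instance) of the abc-iut cell — R2 S-CHAIN TEAM seat abc-iut-s2-p11
(minted target «hplaces»; CLAIM «hplaces-COMPLEMENT» on HOME/STATUS.md 2026-08-26T08:2xZ, piece (P1)). TAKES NO SIDE on [IUTchIII]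
Cor. 3.12: elementary bookkeeping about the INDEX SETS of abc-iut-c312-5's `Thm311.Real.thetaIndex X` (Dupuy–Hilado pilot data `X` of
`F`: `V = 𝕍(F)` = `Thm311.Real.Place F`, `V^bad = S`) and abc-iut-L5-t2's REAL `InitialThetaData` (`D.V = V̲ ⊆ V(K)`, `D.Vbad = V̲^bad`).

CONTEXT. The branch-C certificate at the genuine setting (`Conditional/AbcOfSGenuine.lean` v3/v4) carried the READ binder
`hplaces : ∃ e : (thetaIndex X).V ≃ D.V, ∀ v, v ∈ (thetaIndex X).Vbad ↔ ((e v : D.V) : Val K) ∈ D.Vbad` (abc-iut-c312-7's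
`isSettingOf_settingPrVolSharp`, field `IsSettingOf.places` of abc-iut-c312-8). That binder is IDLE for the certificate's conclusion
and has been DELETED (`Conditional/AbcOfSGenuinePlaces.lean`, p432598); as typed it is a CARDINALITY condition (abc-iut-w6-d105
`Cor312PlacesBadCount.lean` p432526: `|S| = |V̲^bad|` iff `finBelow` is injective on `𝕍(F)^bad`; abc-iut-w4-d020 / w4-d054: the
bijection from the count). THIS FILE records what the index bookkeeping between the two sides REALLY is, with no side condition:
under abc-iut-c312-8's provenance link `Cor312Prov.IsPilotDataOf D X` (`S = 𝕍(F)^bad`),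

* `exists_placeProj` / `placeProj_unique` — there is exactly one map `π : 𝕍(F) → V̲` COMPATIBLE WITH RESTRICTION TO `V_mod`
  (`toVMod (π v) = v|_{F_mod}`: the member of `V̲` over the same valuation of `F_mod`; built from L5-t2's `underline`, the inverse
  of the bijection `V̲ ⥲ V_mod` of Def. 3.1 (e));
* `placeProj_surjective` — `π` is SURJECTIVE (every valuation of `F_mod` extends to `F`, L5-t2's `Val.restrict_surjective` = "the
  natural surjection" of Def. 3.1 (e));
* `mem_Vbad_iff_placeProj_mem` — `v ∈ S ↔ π v ∈ V̲^bad`: the bad DH index set IS the preimage of `V̲^bad` (Def. 3.1 (b)'s fibre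
  product `𝕍(F)^bad := 𝕍^bad_mod ×_{𝕍_mod} 𝕍(F)` read through the link), hence `placeProj_image_Vbad`: `π(S) = V̲^bad`
  (= abc-iut-c312-5's `(thetaIndexOfInitial D).Vbad`, `placeProj_image_Vbad_eq_thetaIndexOfInitial_Vbad`);
* `placeProj_inr_eq_iff` — two finite places of `F` have the same image iff they lie over the same place of `F_mod`
  (`InitialThetaData.finBelow`), so `π` is NOT injective as soon as one place of `F_mod` has two places of `F` above it
  (`not_injective_placeProj_of_two_above`), and `injOn_placeProj_Vbad_iff`: `π` is injective on `S` iff `finBelow` is injective on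
  `𝕍(F)^bad` — abc-iut-w6-d105's numeric condition `IsPilotDataOf.card_S_eq_ncard_Vbad_iff`, i.e. exactly when the deleted `hplaces` holds;
* the headline in the SHAPE of the deleted binder with `≃` weakened to a surjection, `exists_placeProj_surjective_mem_Vbad_iff`:
  `∃ π : (thetaIndex X).V → D.V, Function.Surjective π ∧ ∀ v, v ∈ (thetaIndex X).Vbad ↔ ((π v : D.V) : Val K) ∈ D.Vbad` — the
  provenance sentence available to the certificate for EVERY genuine datum («the DH index set `𝕍(F)` lies OVER `V̲ ≅ V_mod`, with
  `𝕍(F)^bad` the preimage of `V̲^bad`»).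

HONEST FRAMING: bookkeeping about OUR typed index sets, proved in the kernel; nothing here asserts or denies [IUTchIII] Cor. 3.12 or
abc, or takes a side on any author (Mochizuki / Scholze–Stix / Joshi / Dupuy–Hilado); typed ≠ proved; instantiated ≠ endorsed.
[claim: Mochizuki2012, status: disputed] for the quoted definitions. [cite: Mochizuki2012, IUTchI Def. 3.1 (b)(e) pp. 61–62; IUTchIV
Thm. 1.10 p. 23] [cite: DupuyHilado2025, §3.3, §3.6]
-/

noncomputable section

open NumberField IsDedekindDomain Set

namespace Summit.ABC.IUTFork.Cor312Prov

open Literature.IUT.HodgeTheaters Literature.IUT.LogVolume Thm311 Thm311.Real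

variable {F K Fbar : Type} [Field F] [NumberField F] [Field K] [NumberField K] [Algebra F K] [Field Fbar]
  [Algebra F Fbar] [Algebra K Fbar] {E : WeierstrassCurve F} [E.IsElliptic] {l : ℕ} {Pb : BadPlacePredicates K}
  (D : InitialThetaData F K Fbar E l Pb) {X : PilotData F}

/-! ## 1. The natural projection `𝕍(F) → V̲`: existence, uniqueness, surjectivity -/

/-- **Existence of the natural projection `π : 𝕍(F) → V̲`** COMPATIBLE WITH RESTRICTION TO `V_mod`: `π v` is the member of `V̲`
lying over the valuation `v|_{F_mod}` of `F_mod` (`toVMod (π v) = v|_{F_mod}`; archimedean `v = w`: `(Val.arc w)|_{F_mod}`, finite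
`v = 𝔭`: `(Val.non 𝔭)|_{F_mod}`) — L5-t2's `v ↦ v̲` (`InitialThetaData.underline`, the inverse of the bijection `V̲ ⥲ V_mod` of
[IUTchI] Def. 3.1 (e)) after restriction of valuations `V(F) → V_mod`. PROVED (classical bookkeeping).
[cite: Mochizuki2012, IUTchI Def. 3.1 (e) p. 62] [claim: Mochizuki2012, status: disputed] -/
theorem exists_placeProj :
    ∃ π : Place F → D.V, ∀ v : Place F, toVMod F K E ((π v : D.V) : Val K) =
      Val.restrict (fieldOfModuli E) (Sum.elim Val.arc (fun 𝔭 => Val.non (FinitePlace.mk 𝔭)) v) :=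
  ⟨fun v => ⟨D.underline (Val.restrict (fieldOfModuli E) (Sum.elim Val.arc (fun 𝔭 => Val.non (FinitePlace.mk 𝔭)) v)),
    D.underline_mem _⟩, fun _ => D.toVMod_underline _⟩

/-- **Uniqueness**: a map `𝕍(F) → V̲` compatible with restriction to `V_mod` is unique (`V̲ → V_mod` is injective, Def. 3.1 (e)
"a natural bijection `V̲ ⥲ V_mod`", L5-t2's `toVMod_injOn`). PROVED. [cite: Mochizuki2012, IUTchI Def. 3.1 (e) p. 62]
[claim: Mochizuki2012, status: disputed] -/
theorem placeProj_unique {π π' : Place F → D.V}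
    (hπ : ∀ v : Place F, toVMod F K E ((π v : D.V) : Val K) =
      Val.restrict (fieldOfModuli E) (Sum.elim Val.arc (fun 𝔭 => Val.non (FinitePlace.mk 𝔭)) v))
    (hπ' : ∀ v : Place F, toVMod F K E ((π' v : D.V) : Val K) =
      Val.restrict (fieldOfModuli E) (Sum.elim Val.arc (fun 𝔭 => Val.non (FinitePlace.mk 𝔭)) v)) :
    π = π' :=
  funext fun v => Subtype.ext (D.eq_of_toVMod_eq (π v).2 (π' v).2 (by rw [hπ, hπ']))

/-- **Surjectivity**: the natural projection `𝕍(F) → V̲` is ONTO — every valuation of `F_mod` extends to `F` ([IUTchI] Def. 3.1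
(e) "the natural surjection `V(K) ↠ V_mod`"; L5-t2's `Val.restrict_surjective`: `InfinitePlace.comap_surjective` / going up), and a
member of `V̲` is determined by the valuation of `F_mod` below it. PROVED. [cite: Mochizuki2012, IUTchI Def. 3.1 (e) p. 62]
[claim: Mochizuki2012, status: disputed] -/
theorem placeProj_surjective {π : Place F → D.V}
    (hπ : ∀ v : Place F, toVMod F K E ((π v : D.V) : Val K) =
      Val.restrict (fieldOfModuli E) (Sum.elim Val.arc (fun 𝔭 => Val.non (FinitePlace.mk 𝔭)) v)) :
    Function.Surjective π := by
  intro u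
  obtain ⟨w, hw⟩ := Val.restrict_surjective (fieldOfModuli E) (M := F) (toVMod F K E (u : Val K))
  -- a valuation of `F` over `u|_{F_mod}`, read as a place of `F` (archimedean, resp. the prime of a finite place)
  rcases w with a | x
  · refine ⟨Sum.inl a, Subtype.ext (D.eq_of_toVMod_eq (π _).2 u.2 ?_)⟩
    rw [hπ]
    exact hw
  · refine ⟨Sum.inr (FinitePlace.maximalIdeal x), Subtype.ext (D.eq_of_toVMod_eq (π _).2 u.2 ?_)⟩
    rw [hπ, Sum.elim_inr, FinitePlace.mk_maximalIdeal]
    exact hw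

/-! ## 2. Bad places: `S = 𝕍(F)^bad` is the preimage of `V̲^bad` -/

omit [NumberField K] [Algebra F K] [Algebra F Fbar] [Algebra K Fbar] in
/-- The restriction to `F_mod` of an archimedean valuation of `F` is not the valuation of a finite place (restriction respects
the two kinds, [IUTchI] §0 p. 35). [folklore] -/
theorem restrict_arc_not_mem_image_non (a : InfinitePlace F) (T : Set (FinitePlace (fieldOfModuli E))) :
    Val.restrict (fieldOfModuli E) (Val.arc a) ∉ Val.non '' T := by
  rintro ⟨u, -, hu⟩
  exact absurd hu Sum.inr_ne_inl

/-- **`v ∈ S ↔ π v ∈ V̲^bad`** under the provenance link `IsPilotDataOf D X` (`S = 𝕍(F)^bad := 𝕍^bad_mod ×_{𝕍_mod} 𝕍(F)`, [IUTchI]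
Def. 3.1 (b), compared through `FinitePlace.maximalIdeal`): a place of `F` is a bad Dupuy–Hilado index iff the member of `V̲` below-and-up
lies in `V̲^bad` (L5-t2: "the members of `V̲` lying over `V^bad_mod`"). So the bad DH index set is EXACTLY the preimage of `V̲^bad`
under the natural projection — for every genuine datum, with no side condition. PROVED.
[cite: Mochizuki2012, IUTchI Def. 3.1 (b)(e) pp. 61–62] [cite: DupuyHilado2025, §3.3] [claim: Mochizuki2012, status: disputed] -/
theorem mem_Vbad_iff_placeProj_mem (hX : IsPilotDataOf D X) {π : Place F → D.V}
    (hπ : ∀ v : Place F, toVMod F K E ((π v : D.V) : Val K) =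
      Val.restrict (fieldOfModuli E) (Sum.elim Val.arc (fun 𝔭 => Val.non (FinitePlace.mk 𝔭)) v))
    (v : Place F) : v ∈ (thetaIndex X).Vbad ↔ ((π v : D.V) : Val K) ∈ D.Vbad := by
  -- `π v ∈ V̲` always, so `π v ∈ V̲^bad` iff the valuation of `F_mod` below `v` lies in `V^bad_mod`
  have hR : ((π v : D.V) : Val K) ∈ D.Vbad ↔
      Val.restrict (fieldOfModuli E) (Sum.elim Val.arc (fun 𝔭 => Val.non (FinitePlace.mk 𝔭)) v) ∈
        Val.non '' D.VbadMod := by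
    rw [← hπ]
    exact ⟨fun h => h.2, fun h => ⟨(π v).2, h⟩⟩
  rw [hR, mem_thetaIndex_Vbad_iff]
  rcases v with a | 𝔭
  · -- archimedean: neither side holds
    constructor
    · rintro ⟨s, -, hs⟩
      exact absurd hs Sum.inl_ne_inr
    · intro h
      exact absurd h (restrict_arc_not_mem_image_non a D.VbadMod)
  · -- finite: `𝔭 ∈ S ↔ FinitePlace.mk 𝔭 ∈ 𝕍(F)^bad ↔ 𝔭|_{F_mod} ∈ V^bad_mod`
    rw [Sum.elim_inr]
    constructor
    · rintro ⟨s, hs, hs'⟩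
      obtain rfl : 𝔭 = s := Sum.inr_injective hs'
      exact (hX.mem_S_iff (FinitePlace.mk 𝔭)).mp (by rw [FinitePlace.maximalIdeal_mk]; exact hs)
    · intro h
      refine ⟨𝔭, ?_, rfl⟩
      have h' := (hX.mem_S_iff (FinitePlace.mk 𝔭)).mpr h
      rwa [FinitePlace.maximalIdeal_mk] at h'

/-- **`π(S) = V̲^bad`**: the natural projection maps the bad DH index set ONTO `V̲^bad` (surjective + preimage). PROVED.
[cite: Mochizuki2012, IUTchI Def. 3.1 (b)(e) pp. 61–62] [claim: Mochizuki2012, status: disputed] -/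
theorem placeProj_image_Vbad (hX : IsPilotDataOf D X) {π : Place F → D.V}
    (hπ : ∀ v : Place F, toVMod F K E ((π v : D.V) : Val K) =
      Val.restrict (fieldOfModuli E) (Sum.elim Val.arc (fun 𝔭 => Val.non (FinitePlace.mk 𝔭)) v)) :
    π '' (thetaIndex X).Vbad = {u : D.V | (u : Val K) ∈ D.Vbad} := by
  ext u
  constructor
  · rintro ⟨v, hv, rfl⟩
    exact (mem_Vbad_iff_placeProj_mem D hX hπ v).mp hv
  · intro hu
    obtain ⟨v, rfl⟩ := placeProj_surjective D hπ u
    exact ⟨v, (mem_Vbad_iff_placeProj_mem D hX hπ v).mpr hu, rfl⟩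

/-- The same image statement against abc-iut-c312-5's index skeleton FROM the initial Θ-data (`Thm311.Real.thetaIndexOfInitial D`:
`V := V̲`, `V^bad := V̲^bad`): the natural projection carries `(thetaIndex X).Vbad` onto `(thetaIndexOfInitial D).Vbad` — the
«re-index over `thetaIndexOfInitial`» content of the bookkeeping, as a surjection of index sets. PROVED.
[claim: Mochizuki2012, status: disputed] -/
theorem placeProj_image_Vbad_eq_thetaIndexOfInitial_Vbad (hX : IsPilotDataOf D X) {π : Place F → D.V}
    (hπ : ∀ v : Place F, toVMod F K E ((π v : D.V) : Val K) =
      Val.restrict (fieldOfModuli E) (Sum.elim Val.arc (fun 𝔭 => Val.non (FinitePlace.mk 𝔭)) v)) :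
    π '' (thetaIndex X).Vbad = (thetaIndexOfInitial D).Vbad :=
  placeProj_image_Vbad D hX hπ

/-! ## 3. Fibres: `π` is a bijection on the bad part iff no place of `𝕍^bad_mod` has two places of `F` above it -/

/-- **Fibres of the natural projection at finite places**: two primes of `𝓞 F` have the same image in `V̲` iff they lie over the
same place of `F_mod` (L5-t2's `InitialThetaData.finBelow`). PROVED. [cite: Mochizuki2012, IUTchI Def. 3.1 (e) p. 62]
[claim: Mochizuki2012, status: disputed] -/
theorem placeProj_inr_eq_iff {π : Place F → D.V}
    (hπ : ∀ v : Place F, toVMod F K E ((π v : D.V) : Val K) =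
      Val.restrict (fieldOfModuli E) (Sum.elim Val.arc (fun 𝔭 => Val.non (FinitePlace.mk 𝔭)) v))
    (𝔭₁ 𝔭₂ : HeightOneSpectrum (𝓞 F)) :
    π (Sum.inr 𝔭₁) = π (Sum.inr 𝔭₂) ↔
      InitialThetaData.finBelow (E := E) (FinitePlace.mk 𝔭₁) = InitialThetaData.finBelow (E := E) (FinitePlace.mk 𝔭₂) := by
  -- `toVMod (π 𝔭ᵢ) = (Val.non (mk 𝔭ᵢ))|_{F_mod} = Val.non (finBelow (mk 𝔭ᵢ))` (definitional unfolding of `Val.restrict`)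
  have h₁ : toVMod F K E ((π (Sum.inr 𝔭₁) : D.V) : Val K) =
      Val.non (InitialThetaData.finBelow (E := E) (FinitePlace.mk 𝔭₁)) := by rw [hπ]; rfl
  have h₂ : toVMod F K E ((π (Sum.inr 𝔭₂) : D.V) : Val K) =
      Val.non (InitialThetaData.finBelow (E := E) (FinitePlace.mk 𝔭₂)) := by rw [hπ]; rfl
  constructor
  · intro h
    have h' : toVMod F K E ((π (Sum.inr 𝔭₁) : D.V) : Val K) = toVMod F K E ((π (Sum.inr 𝔭₂) : D.V) : Val K) := by
      rw [h]
    rw [h₁, h₂] at h'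
    exact Sum.inr_injective h'
  · intro h
    refine Subtype.ext (D.eq_of_toVMod_eq (π _).2 (π _).2 ?_)
    rw [h₁, h₂, h]

/-- **No bijection when a place splits**: if two distinct primes of `𝓞 F` lie over the same place of `F_mod`, the natural projection
`𝕍(F) → V̲` is not injective (in particular whenever `[F : F_mod] > 1` some place does; on the bad part this is the failure of the
deleted binder `hplaces`). PROVED. [cite: Mochizuki2012, IUTchI Def. 3.1 (e) p. 62] [claim: Mochizuki2012, status: disputed] -/
theorem not_injective_placeProj_of_two_above {π : Place F → D.V}
    (hπ : ∀ v : Place F, toVMod F K E ((π v : D.V) : Val K) =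
      Val.restrict (fieldOfModuli E) (Sum.elim Val.arc (fun 𝔭 => Val.non (FinitePlace.mk 𝔭)) v))
    {𝔭₁ 𝔭₂ : HeightOneSpectrum (𝓞 F)} (hne : 𝔭₁ ≠ 𝔭₂)
    (hbelow : InitialThetaData.finBelow (E := E) (FinitePlace.mk 𝔭₁) = InitialThetaData.finBelow (E := E) (FinitePlace.mk 𝔭₂)) :
    ¬ Function.Injective π := fun hinj =>
  hne (Sum.inr_injective (hinj ((placeProj_inr_eq_iff D hπ 𝔭₁ 𝔭₂).mpr hbelow)))

/-- **`π` injective on `S` iff `finBelow` injective on `𝕍(F)^bad`** (under `IsPilotDataOf D X`, `S = 𝕍(F)^bad` through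
`FinitePlace.maximalIdeal`): the natural projection is a bijection `S ⥲ V̲^bad` exactly when every place of `𝕍^bad_mod` has ONE place of
`F` above it — abc-iut-w6-d105's numeric condition (`Cor312PlacesBadCount`: `X.S.card = D.Vbad.ncard ↔ Set.InjOn finBelow D.VFbad`), i.e.
exactly when the deleted cardinality binder `hplaces` is satisfiable. PROVED. [cite: Mochizuki2012, IUTchI Def. 3.1 (b)(e) pp. 61–62]
[claim: Mochizuki2012, status: disputed] -/
theorem injOn_placeProj_Vbad_iff (hX : IsPilotDataOf D X) {π : Place F → D.V}
    (hπ : ∀ v : Place F, toVMod F K E ((π v : D.V) : Val K) =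
      Val.restrict (fieldOfModuli E) (Sum.elim Val.arc (fun 𝔭 => Val.non (FinitePlace.mk 𝔭)) v)) :
    Set.InjOn π (thetaIndex X).Vbad ↔ Set.InjOn (InitialThetaData.finBelow (E := E)) D.VFbad := by
  constructor
  · intro hinj x₁ hx₁ x₂ hx₂ h
    have hm₁ : (Sum.inr (FinitePlace.maximalIdeal x₁) : Place F) ∈ (thetaIndex X).Vbad :=
      (mem_thetaIndex_Vbad_iff X _).mpr ⟨_, (hX.mem_S_iff x₁).mpr hx₁, rfl⟩
    have hm₂ : (Sum.inr (FinitePlace.maximalIdeal x₂) : Place F) ∈ (thetaIndex X).Vbad :=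
      (mem_thetaIndex_Vbad_iff X _).mpr ⟨_, (hX.mem_S_iff x₂).mpr hx₂, rfl⟩
    have hπeq : π (Sum.inr (FinitePlace.maximalIdeal x₁)) = π (Sum.inr (FinitePlace.maximalIdeal x₂)) := by
      rw [placeProj_inr_eq_iff D hπ, FinitePlace.mk_maximalIdeal, FinitePlace.mk_maximalIdeal]
      exact h
    exact FinitePlace.maximalIdeal_injective (Sum.inr_injective (hinj hm₁ hm₂ hπeq))
  · intro hinj v₁ hv₁ v₂ hv₂ h
    obtain ⟨s₁, hs₁, rfl⟩ := (mem_thetaIndex_Vbad_iff X v₁).mp hv₁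
    obtain ⟨s₂, hs₂, rfl⟩ := (mem_thetaIndex_Vbad_iff X v₂).mp hv₂
    have hb₁ : FinitePlace.mk s₁ ∈ D.VFbad := (hX.mem_S_iff _).mp (by rw [FinitePlace.maximalIdeal_mk]; exact hs₁)
    have hb₂ : FinitePlace.mk s₂ ∈ D.VFbad := (hX.mem_S_iff _).mp (by rw [FinitePlace.maximalIdeal_mk]; exact hs₂)
    have hmk : FinitePlace.mk s₁ = FinitePlace.mk s₂ := hinj hb₁ hb₂ ((placeProj_inr_eq_iff D hπ s₁ s₂).mp h)
    have hs : s₁ = s₂ := by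
      rw [← FinitePlace.maximalIdeal_mk s₁, ← FinitePlace.maximalIdeal_mk s₂, hmk]
    rw [hs]

/-! ## 4. Headline in the shape of the deleted binder -/

/-- **The provenance sentence for Dupuy–Hilado-indexed settings, for EVERY genuine datum**: under `IsPilotDataOf D X` there is a
SURJECTION `π : (thetaIndex X).V = 𝕍(F) ↠ V̲ = D.V` with `v ∈ (thetaIndex X).Vbad ↔ π v ∈ V̲^bad` — the deleted READ binder
`hplaces : ∃ e : (thetaIndex X).V ≃ D.V, ∀ v, v ∈ (thetaIndex X).Vbad ↔ ((e v : D.V) : Val K) ∈ D.Vbad` of `Conditional/AbcOfSGenuine.lean`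
v3/v4 with `≃` weakened to what [IUTchI] Def. 3.1 (e) actually provides («the natural surjection `V(K) ↠ V_mod`»; the bijection exists
iff `π` is injective on the bad part, `injOn_placeProj_Vbad_iff` + abc-iut-w6-d105 / w4-d020). PROVED; no side condition.
[cite: Mochizuki2012, IUTchI Def. 3.1 (b)(e) pp. 61–62; IUTchIV Thm. 1.10 p. 23] [cite: DupuyHilado2025, §3.3] [claim: Mochizuki2012, status: disputed] -/
theorem exists_placeProj_surjective_mem_Vbad_iff (hX : IsPilotDataOf D X) :
    ∃ π : (thetaIndex X).V → D.V, Function.Surjective π ∧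
      ∀ v : (thetaIndex X).V, v ∈ (thetaIndex X).Vbad ↔ ((π v : D.V) : Val K) ∈ D.Vbad := by
  obtain ⟨π, hπ⟩ := exists_placeProj D
  exact ⟨π, placeProj_surjective D hπ, mem_Vbad_iff_placeProj_mem D hX hπ⟩

end Summit.ABC.IUTFork.Cor312Prov

end
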